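import Literature.Barriers.CriticalPhenomena.GridSAWCountingGridHamPathHardness
import Literature.Barriers.CriticalPhenomena.GridSAWStructuredDrawing
import Literature.Barriers.CriticalPhenomena.GridSAWHamPathCountTransfer
import Literature.Computability.Complexity.KSATReductions
import Literature.Computability.Complexity.CodeFPListKit
import HarnessLib

/-!
# Lemma 4 of Liśkiewicz–Ogihara–Toda from a drawn gadget family: the approach-independent end

The named fact `LOT2003_lemma4_gadgets : SHARP3SATNF ≤ᵖ_{r-shift} GRIDHAMPATHCOUNT`
(`GridSAWCountingGridHamPathHardness.lean`; Liśkiewicz–Ogihara–Toda 2003, Lemma 4 with the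
embedding step `E₀` of the proof of Theorem 7) is the last open input of the whole barrier
`gridSAWCounting_sharpP_complete` (`GridSAWCountingAnyLengthAssembly.lean`). Its printed proof has a
COMBINATORIAL part — a graph `G(ψ)` of maximum degree three with
`#HamPath(G(ψ), s, t) = 2^{e(ψ)} · #SAT(ψ)`, drawn on the grid without vertex congestion — and a
ROUTINE end: number the vertices, code the drawn instance, check the normal form of the input,
send everything else to an instance without Hamiltonian paths, and observe that all of this is
polynomial time ("It is not hard to see that `R` is polynomial-time computable", proof of Lemma 4;
"we apply our embedding algorithm to `G′` … This is `E₀`", proof of Theorem 7). The combinatorial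
part is being formalised in the tree on named vertex sets (`ℕ`-names: the diamond chain of
`HamiltonianDiamondChain.lean` with substituted rail gadgets, `HamiltonianLOTLayout.lean` /
`HamiltonianLOTFamilies.lean`; the grid cells of `GridCells.lean` / `CellChain.lean`). This file
proves the routine end ONCE, for ANY such family, so that a construction only has to deliver
mathematics on names plus a typed polynomial-time witness (`CodeFP`, `CodeFP.lean`) for its lists:

* `SDrawing.hamPathCount_toD_eq_hamCount`, **`SDrawing.IsValid.GRIDHAMPATHCOUNT_encode_eq_hamCount`**
  — for a valid named grid drawing `S : SDrawing ℕ` (`GridSAWStructuredDrawing.lean`) of a graph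
  `G` (adjacency = "some drawn edge joins the two names"), the value of `GRIDHAMPATHCOUNT` on the
  code of the numbered instance `(S.toP, S.toD, S.idx s, S.idx t)` is `hamCount G S.verts s t`
  (numbering by `GridSAWHamPathCountTransfer.hamPathCount_eq_hamCount_of_numbering` along the
  globally injective extension `SDrawing.num` of `S.idx`);
* the codes: `gpC = encodingGridPoint.encode`, `instC = encodingDrawnGraphInstance.encode`
  (`gpC_eq`, `instC_eq`), `cnfC = encodingCNF.encode` (`cnfC_eq`), and the RAW format `ndC` in
  which a construction hands over its named drawing
  `(verts, positions, named edges, s, t) : NamedDrawingData`;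
* **`codeFP_numberND`** — numbering a named drawing (`numberND`: every edge end replaced by its
  index in `verts`) is typed polynomial time `CodeFP ndC instC numberND`;
* **`codeFP_isLOTNormalForm`** — the normal form of Lemma 3 (`CNF.IsLOTNormalForm`: one
  single-literal clause, then complementary pairs of three-literal clauses) is decided in typed
  polynomial time on CNF codes (a left fold carrying the previous clause);
* `zeroInstance` — a valid drawn instance without Hamiltonian paths
  (`GRIDHAMPATHCOUNT_zeroInstance`), the image of the strings that are not codes of normal-form
  formulas;
* **`LOT2003_lemma4_gadgets_of_family`** — `LOT2003_lemma4_gadgets` from: a named drawing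
  `S ψ : SDrawing ℕ`, valid for normal-form `ψ`, of a graph `G ψ` with ends `s ψ, t ψ ∈ verts`
  and `hamCount (G ψ) (S ψ).verts.toFinset (s ψ) (t ψ) = 2 ^ e ψ * ψ.numSat` (`0 < e ψ`), together
  with `CodeFP cnfC ndC` for `ψ ↦ ((S ψ).verts, (S ψ).verts.map (S ψ).pos, (S ψ).edges, s ψ, t ψ)`
  and `CodeFP cnfC natE e`. The reduction is `R₁ w = code (numbered drawing of ψ_w)` if the CNF
  `ψ_w = decCNF w` read by the tree's total decoder is in normal form and `code zeroInstance`
  otherwise, `R₃ w = max 1 (e ψ_w)`; on strings it is the `CodeFP` witness composed with the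
  canonical re-encoding `KSATRed.canonCNFFn` (`w ↦ code (decCNF w)`, in `FP`);
* **`LOT2003_lemma4_grid_of_family`** — with Proposition 2 (`LOT2003_prop2_sharp3SAT_holds`) and
  Lemma 3 (`LOT2003_lemma3_holds`), the same data give `LOT2003_lemma4_grid`
  (`GridSAWCountingViaGridHamPath.lean`) by `LOT2003_lemma4_grid_of_gadgets`.

No statement of the source is weakened: the two theorems discharge the named facts verbatim from
hypotheses that are exactly the printed properties of `G(ψ)` and `E₀` (census with a power-of-two
factor, congestion-free grid drawing of a maximum-degree-three graph, polynomial time).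

## References

* M. Liśkiewicz, M. Ogihara, S. Toda, *The complexity of counting self-avoiding walks in
  subgraphs of two-dimensional grids and hypercubes*, TCS 304 (2003) 129–156, §3 (proof of
  Lemma 4: "It is not hard to see that `R` is polynomial-time computable") and §4 (proof of
  Theorem 7: `E₀`).
* S. Arora, B. Barak, *Computational Complexity: A Modern Approach*, CUP 2009, §0.1 (codes),
  §1.3 (closure of polynomial time under composition and bounded loops).
-/

namespace Literature.Barriers.CriticalPhenomena.GridSAW

open _root_.Computability Polynomial
open Literature.Computability.Complexity (CNF Clause Literal FP encodingCNF SHARP3SATNF CodeFP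
  LOT2003_prop2_sharp3SAT_holds length_boolPair comp_mem_FP)
open Literature.Computability.Complexity.CodeFP (natE unE bitE pairE rawE listE smE pairE_apply rawE_nil
  rawE_cons natE_eq bitE_eq pairE_eq listE_eq natE_injective bitE_injective pairE_injective
  listE_injective length_le_length_rawE length_item_le_length_rawE)
open Literature.Combinatorics.SimpleGraph (hamCount)

/-! ### Numbering a valid named drawing: the value of `GRIDHAMPATHCOUNT` -/

namespace SDrawing

variable (S : SDrawing ℕ)

/-- A globally injective extension of the numbering `idx` of the listed vertices: unlisted names
are sent above `|verts|`. [folklore] -/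
def num (a : ℕ) : ℕ :=
  if a ∈ S.verts then S.idx a else S.verts.length + a

/-- On listed vertices `num` is `idx`. [folklore] -/
theorem num_of_mem {a : ℕ} (ha : a ∈ S.verts) : S.num a = S.idx a := if_pos ha

/-- `num` is injective when the vertex list has no duplicates. [folklore] -/
theorem num_injective (hS : S.verts.Nodup) : Function.Injective S.num := by
  intro a b h
  by_cases ha : a ∈ S.verts <;> by_cases hb : b ∈ S.verts
  · rw [S.num_of_mem ha, S.num_of_mem hb] at h
    exact (S.idx_inj ha).1 h
  · rw [S.num_of_mem ha, num, if_neg hb] at h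
    have := S.idx_lt_length ha
    omega
  · rw [num, if_neg ha, S.num_of_mem hb] at h
    have := S.idx_lt_length hb
    omega
  · rw [num, if_neg ha, num, if_neg hb] at h
    have _ := hS
    omega

/-- The numbering maps the listed vertices onto `0, …, |verts| - 1`. [folklore] -/
theorem image_num_eq_range (hS : S.verts.Nodup) :
    S.verts.toFinset.image S.num = Finset.range S.verts.length := by
  rw [← S.image_idx_eq_range hS]
  exact Finset.image_congr fun a ha => S.num_of_mem (List.mem_toFinset.1 ha)

/-- **Numbering transfers the count**: for a valid named drawing of `G` (adjacency of `G` on the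
listed names = joined by a drawn edge), the number of Hamiltonian `idx s`–`idx t` paths of the
numbered instance is `hamCount G verts s t`.
[cite: LiskiewiczOgiharaToda2003, §4 (proof of Theorem 7: the instance `(E₀, s′, t′)`)] -/
theorem hamPathCount_toD_eq_hamCount (hS : S.IsValid) {G : _root_.SimpleGraph ℕ}
    (hG : ∀ a ∈ S.verts, ∀ b ∈ S.verts,
      G.Adj a b ↔ ∃ e ∈ S.edges, (e.1 = a ∧ e.2.1 = b) ∨ (e.1 = b ∧ e.2.1 = a))
    {s t : ℕ} (hs : s ∈ S.verts) (ht : t ∈ S.verts) :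
    hamPathCount S.verts.length S.toD (S.idx s) (S.idx t) = hamCount G S.verts.toFinset s t := by
  have hnd := hS.nodup_verts
  have hD : ∀ a ∈ S.verts.toFinset, ∀ b ∈ S.verts.toFinset,
      G.Adj a b ↔ (S.num a ≠ S.num b ∧ DAdj S.toD (S.num a) (S.num b)) := by
    intro a ha b hb
    rw [List.mem_toFinset] at ha hb
    rw [S.num_of_mem ha, S.num_of_mem hb, hS.dAdj_toD_iff ha hb, hG a ha b hb, Ne, S.idx_inj ha]
    constructor
    · intro h
      refine ⟨?_, h⟩
      rintro rfl
      obtain ⟨e, he, h⟩ := h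
      rcases h with ⟨h1, h2⟩ | ⟨h1, h2⟩ <;> exact hS.fst_ne_snd e he (h1.trans h2.symm)
    · exact fun h => h.2
  have h := hamPathCount_eq_hamCount_of_numbering (S.num_injective hnd) (S.image_num_eq_range hnd) hD s t
  rwa [S.num_of_mem hs, S.num_of_mem ht] at h

/-- **The value of `GRIDHAMPATHCOUNT` on the numbered instance of a valid named drawing** is the
number of Hamiltonian `s`–`t` paths of the named graph.
[cite: LiskiewiczOgiharaToda2003, §4 (proof of Theorem 7, `E₀`)] -/
theorem IsValid.GRIDHAMPATHCOUNT_encode_eq_hamCount (hS : S.IsValid) {G : _root_.SimpleGraph ℕ}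
    (hG : ∀ a ∈ S.verts, ∀ b ∈ S.verts,
      G.Adj a b ↔ ∃ e ∈ S.edges, (e.1 = a ∧ e.2.1 = b) ∨ (e.1 = b ∧ e.2.1 = a))
    {s t : ℕ} (hs : s ∈ S.verts) (ht : t ∈ S.verts) :
    GRIDHAMPATHCOUNT (encodingDrawnGraphInstance.encode (S.toP, S.toD, S.idx s, S.idx t)) =
      hamCount G S.verts.toFinset s t := by
  rw [GRIDHAMPATHCOUNT_encode _ _ _ _ hS.isGridDrawing
      (by rw [S.length_toP]; exact S.idx_lt_length hs) (by rw [S.length_toP]; exact S.idx_lt_length ht),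
    S.length_toP, S.hamPathCount_toD_eq_hamCount hS hG hs ht]

end SDrawing

/-! ### Codes -/

/-- Literals `(x, b) ↦ ⟨bin x, [b]⟩` (the `encode` of `encodingLiteral`). [cite: AroraBarak2009, §0.1] -/
abbrev litC : Literal ℕ → List Bool := pairE natE bitE

/-- Clauses (the `encode` of `encodingClause`). [cite: AroraBarak2009, §0.1] -/
abbrev clauseC : Clause ℕ → List Bool := listE litC

/-- CNFs (the `encode` of `encodingCNF`). [cite: AroraBarak2009, §0.1] -/
abbrev cnfC : CNF ℕ → List Bool := listE clauseC

/-- `cnfC` is the tree's CNF code. [folklore] -/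
theorem cnfC_eq : (encodingCNF.encode : CNF ℕ → List Bool) = cnfC := by
  rw [encodingCNF, listE_eq, Literature.Computability.Complexity.encodingClause, listE_eq,
    Literature.Computability.Complexity.encodingLiteral, pairE_eq, natE_eq, bitE_eq]

/-- Grid points (the `encode` of `encodingGridPoint`: two sign–magnitude integers). [cite: AroraBarak2009, §0.1] -/
abbrev gpC : GridPoint → List Bool := pairE smE smE

/-- `gpC` is the tree's grid-point code. [folklore] -/
theorem gpC_eq : (encodingGridPoint.encode : GridPoint → List Bool) = gpC := by
  rw [encodingGridPoint, pairE_eq]; rfl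

/-- Numbered drawn edges `(i, j, π)` (the `encode` of `encodingDrawnEdge`). [cite: AroraBarak2009, §0.1] -/
abbrev dedgeC : DrawnEdge → List Bool := pairE natE (pairE natE (listE gpC))

/-- Drawn instances `(P, D, s, t)` (the `encode` of `encodingDrawnGraphInstance`). [cite: AroraBarak2009, §0.1] -/
abbrev instC : DrawnGraphInstance → List Bool :=
  pairE (listE gpC) (pairE (listE dedgeC) (pairE natE natE))

/-- `instC` is the tree's instance code of `GRIDHAMPATHCOUNT`. [folklore] -/
theorem instC_eq : (encodingDrawnGraphInstance.encode : DrawnGraphInstance → List Bool) = instC := by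
  rw [encodingDrawnGraphInstance, pairE_eq, listE_eq, pairE_eq, listE_eq, encodingDrawnEdge, pairE_eq,
    pairE_eq, listE_eq, pairE_eq, gpC_eq, natE_eq]

/-- **The data a construction hands over**: the vertex names in numbering order, their positions
(aligned with the names), the named drawn edges, and the two end vertices. [cite: LiskiewiczOgiharaToda2003, §4 (E₀)] -/
abbrev NamedDrawingData : Type := List ℕ × List GridPoint × List (SEdge ℕ) × ℕ × ℕ

/-- Named drawn edges `(a, b, π)`, raw format (no length header on the path). [cite: AroraBarak2009, §0.1] -/
abbrev sedgeC : SEdge ℕ → List Bool := pairE natE (pairE natE (rawE gpC))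

/-- The raw code of `NamedDrawingData` (lists without length headers, the format the list
combinators of `CodeFP.lean` produce). [cite: AroraBarak2009, §0.1] -/
abbrev ndC : NamedDrawingData → List Bool :=
  pairE (rawE natE) (pairE (rawE gpC) (pairE (rawE sedgeC) (pairE natE natE)))

/-- **Numbering a named drawing**: every edge end and the two distinguished vertices are replaced
by their index in the vertex list (`List.idxOf`; this is `SDrawing.toP`, `SDrawing.toD`,
`SDrawing.idx` on the data of an `SDrawing`, `numberND_sdrawing`). [cite: LiskiewiczOgiharaToda2003, §4 (E₀)] -/
def numberND (d : NamedDrawingData) : DrawnGraphInstance :=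
  (d.2.1, d.2.2.1.map fun e => (d.1.idxOf e.1, d.1.idxOf e.2.1, e.2.2), d.1.idxOf d.2.2.2.1,
    d.1.idxOf d.2.2.2.2)

/-- On the data of a named drawing, `numberND` is the numbered instance. [folklore] -/
theorem numberND_sdrawing (S : SDrawing ℕ) (s t : ℕ) :
    numberND (S.verts, S.verts.map S.pos, S.edges, s, t) = (S.toP, S.toD, S.idx s, S.idx t) := rfl

/-! ### Numbering is typed polynomial time -/

section fp

open Literature.Computability.Complexity.CodeFP

/-- The index of a name in a list of names (`List.idxOf`, `|l|` if absent). [cite: AroraBarak2009, §1.3] -/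
theorem codeFP_idxOf : CodeFP (pairE natE (rawE natE)) natE (fun q => q.2.idxOf q.1) :=
  (findIdxFP (σ := ℕ) (eσ := natE) (eα := natE) (p := fun t => t.2 == t.1)
    ((beq natE_injective).comp ((snd _ _).pair (fst _ _)))).congr fun _ => rfl

/-- **Numbering a named drawing is typed polynomial time.** [cite: AroraBarak2009, §1.3] -/
theorem codeFP_numberND : CodeFP ndC instC numberND := by
  -- context: the vertex list; item: a named edge
  have hidx : ∀ {γ : Type} {eγ : γ → List Bool} {g : γ → List ℕ × ℕ},
      CodeFP eγ (pairE (rawE natE) natE) g → CodeFP eγ natE (fun c => (g c).1.idxOf (g c).2) :=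
    fun hg => (codeFP_idxOf.comp (hg.snd'.pair hg.fst')).congr fun _ => rfl
  have hedge : CodeFP (pairE (rawE natE) sedgeC) dedgeC
      (fun p => (p.1.idxOf p.2.1, p.1.idxOf p.2.2.1, p.2.2.2)) := by
    have h1 : CodeFP (pairE (rawE natE) sedgeC) natE (fun p => p.1.idxOf p.2.1) :=
      hidx ((fst _ _).pair (snd _ _).fst')
    have h2 : CodeFP (pairE (rawE natE) sedgeC) natE (fun p => p.1.idxOf p.2.2.1) :=
      hidx ((fst _ _).pair (snd _ _).snd'.fst')
    have h3 : CodeFP (pairE (rawE natE) sedgeC) (listE gpC) (fun p => p.2.2.2) :=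
      (listOfRaw gpC).comp (snd _ _).snd'.snd'
    exact h1.pair (h2.pair h3)
  have hedges : CodeFP ndC (listE dedgeC)
      (fun d => d.2.2.1.map fun e => (d.1.idxOf e.1, d.1.idxOf e.2.1, e.2.2)) :=
    (listOfRaw dedgeC).comp ((map hedge).comp ((fst _ _).pair (snd _ _).snd'.fst'))
  have hP : CodeFP ndC (listE gpC) (fun d => d.2.1) := (listOfRaw gpC).comp (snd _ _).fst'
  have hs : CodeFP ndC natE (fun d => d.1.idxOf d.2.2.2.1) :=
    hidx ((fst _ _).pair (snd _ _).snd'.snd'.fst')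
  have ht : CodeFP ndC natE (fun d => d.1.idxOf d.2.2.2.2) :=
    hidx ((fst _ _).pair (snd _ _).snd'.snd'.snd')
  exact (hP.pair (hedges.pair (hs.pair ht))).congr fun _ => rfl

/-! ### The normal form of Lemma 3 is decided in typed polynomial time -/

/-- The literal-wise complement of a clause on raw codes. [cite: LiskiewiczOgiharaToda2003, §2.3 (proof of Lemma 3)] -/
theorem codeFP_complement : CodeFP clauseC clauseC Clause.complement := by
  have hneg : CodeFP litC litC Literal.negate :=
    ((fst _ _).pair (CodeFP.not (snd _ _))).congr fun l => by rfl
  exact ((listOfRaw litC).comp ((map₀ hneg).comp (rawOfList litC))).congr fun _ => rfl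

/-- The accumulator of the normal-form fold: `(ok, pending, D)` — no violation so far, whether
the next clause must be the complement of the stored clause `D`. [folklore] -/
def cpStep (acc : Bool × Bool × Clause ℕ) (c : Clause ℕ) : Bool × Bool × Clause ℕ :=
  if acc.2.1 then (acc.1 && decide (c = acc.2.2.complement), false, [])
  else (acc.1 && decide (c.length = 3), true, c)

/-- The fold decides `IsComplPairs` (two clauses at a time). [cite: LiskiewiczOgiharaToda2003, Lemma 3 (1)] -/
theorem cpStep_foldl : ∀ (l : List (Clause ℕ)) (ok : Bool),
    ((l.foldl cpStep (ok, false, [])).1 && !(l.foldl cpStep (ok, false, [])).2.1) =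
      (ok && decide (CNF.IsComplPairs l))
  | [], ok => by simp
  | [c], ok => by simp [cpStep, CNF.IsComplPairs]
  | c :: c' :: rest, ok => by
    rw [List.foldl_cons, List.foldl_cons]
    have hstep : cpStep (cpStep (ok, false, []) c) c' =
        (ok && decide (c.length = 3) && decide (c' = c.complement), false, []) := by
      simp [cpStep]
    rw [hstep, cpStep_foldl rest]
    by_cases h1 : c.length = 3 <;> by_cases h2 : c' = c.complement <;>
      by_cases h3 : CNF.IsComplPairs rest <;> simp [h1, h2, h3]

/-- The stored clause of the accumulator is a member of the folded list (or empty). [folklore] -/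
theorem cpStep_foldl_mem (l₀ : List (Clause ℕ)) : ∀ (l : List (Clause ℕ)) (acc : Bool × Bool × Clause ℕ),
    (∀ c ∈ l, c ∈ l₀) → (acc.2.2 = [] ∨ acc.2.2 ∈ l₀) →
      (l.foldl cpStep acc).2.2 = [] ∨ (l.foldl cpStep acc).2.2 ∈ l₀
  | [], acc, _, hacc => by simpa using hacc
  | c :: l, acc, hl, _ => by
    rw [List.foldl_cons]
    refine cpStep_foldl_mem l₀ l _ (fun x hx => hl x (List.mem_cons_of_mem _ hx)) ?_
    unfold cpStep
    split_ifs
    · exact Or.inl rfl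
    · exact Or.inr (hl c List.mem_cons_self)

/-- `IsLOTNormalForm` as a Boolean function of the clause list. [cite: LiskiewiczOgiharaToda2003, Lemma 3 (1)] -/
def isNFB (ψ : CNF ℕ) : Bool :=
  decide (ψ ≠ []) && decide ((ψ.headD []).length = 1) &&
    ((ψ.tail.foldl cpStep (true, false, [])).1 && !(ψ.tail.foldl cpStep (true, false, [])).2.1)

/-- `isNFB` decides the normal form. [cite: LiskiewiczOgiharaToda2003, Lemma 3 (1)] -/
theorem isNFB_eq (ψ : CNF ℕ) : isNFB ψ = decide ψ.IsLOTNormalForm := by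
  rw [isNFB, cpStep_foldl, Bool.true_and]
  rcases ψ with _ | ⟨c, rest⟩
  · simp [CNF.IsLOTNormalForm]
  · rcases c with _ | ⟨l, _ | ⟨l', c⟩⟩
    · simp [CNF.IsLOTNormalForm]
    · simp
    · simp [CNF.IsLOTNormalForm]

/-- **The normal form of Lemma 3 is decided in typed polynomial time on CNF codes.**
[cite: AroraBarak2009, §1.3 (polynomially bounded loops)] -/
theorem codeFP_isLOTNormalForm : CodeFP cnfC bitE (fun ψ => decide ψ.IsLOTNormalForm) := by
  have hinj : Function.Injective clauseC := listE_injective (pairE_injective natE_injective bitE_injective)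
  -- the step of the fold, on codes: context `Unit`, item a clause, accumulator `(ok, pending, D)`
  let accC : Bool × Bool × Clause ℕ → List Bool := pairE bitE (pairE bitE clauseC)
  have hA : CodeFP (pairE unitE (pairE clauseC accC)) accC (fun t => t.2.2) := (snd _ _).snd'
  have hc : CodeFP (pairE unitE (pairE clauseC accC)) clauseC (fun t => t.2.1) := (snd _ _).fst'
  have hlen : CodeFP clauseC natE List.length := (natLength litC).comp (rawOfList litC)
  have hstep : CodeFP (pairE unitE (pairE clauseC accC)) accC (fun t => cpStep t.2.2 t.2.1) := by
    refine (hA.snd'.fst'.ite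
      (((hA.fst'.and ((CodeFP.eq hinj).comp (hc.pair (codeFP_complement.comp hA.snd'.snd')))).pair
        ((const _ false).pair (const _ ([] : Clause ℕ)))))
      ((hA.fst'.and (natEq.comp ((hlen.comp hc).pair (const _ 3)))).pair
        ((const _ true).pair hc))).congr fun t => ?_
    simp only [cpStep]
  have hfold := foldl (σ := Unit) (eσ := unitE) (eα := clauseC) (eβ := accC)
    (step := fun _ c acc => cpStep acc c) (init := fun _ => (true, false, ([] : Clause ℕ)))
    hstep (const unitE (true, false, ([] : Clause ℕ))) (X + 12) (fun u l₁ l₂ => by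
      have hmem := cpStep_foldl_mem (l₁ ++ l₂) l₁ (true, false, []) (fun c hc => List.mem_append_left _ hc)
        (Or.inl rfl)
      set acc := l₁.foldl cpStep (true, false, []) with hacc
      have hD : (clauseC acc.2.2).length ≤ (rawE clauseC (l₁ ++ l₂)).length + 2 := by
        rcases hmem with h | h
        · rw [h]; simp [clauseC, listE]
        · have := length_item_le_length_rawE clauseC h; omega
      have h1 : (accC acc).length = 8 + (clauseC acc.2.2).length := by
        simp only [accC, pairE_apply, length_boolPair, bitE, List.length_singleton]; omega
      change (accC acc).length ≤ _
      rw [h1, pairE_apply, length_boolPair, eval_add, eval_X]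
      simp only [eval_ofNat]
      omega)
  -- assemble `isNFB`
  have htail : CodeFP cnfC (rawE clauseC) List.tail := (rawTail clauseC).comp (rawOfList clauseC)
  have hfoldψ : CodeFP cnfC accC (fun ψ => ψ.tail.foldl cpStep (true, false, [])) :=
    (hfold.comp ((const _ ()).pair htail)).congr fun _ => rfl
  have hne : CodeFP cnfC bitE (fun ψ => decide (ψ ≠ [])) :=
    (CodeFP.not ((rawIsEmpty clauseC).comp (rawOfList clauseC))).congr fun ψ => by
      cases ψ <;> simp
  have hhead : CodeFP cnfC bitE (fun ψ => decide ((ψ.headD []).length = 1)) :=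
    natEq.comp ((hlen.comp ((rawHeadOr clauseC).comp ((const _ ([] : Clause ℕ)).pair (rawOfList clauseC)))).pair
      (const _ 1))
  refine ((hne.and hhead).and (hfoldψ.fst'.and (CodeFP.not hfoldψ.snd'.fst'))).congr fun ψ => ?_
  rw [← isNFB_eq, isNFB]

/-- The shift `max 1 (e ψ)` is typed polynomial time if `e` is. [cite: AroraBarak2009, §1.3] -/
theorem codeFP_max_one {e : CNF ℕ → ℕ} (he : CodeFP cnfC natE e) :
    CodeFP cnfC natE (fun ψ => max 1 (e ψ)) :=
  natMax.comp ((const _ 1).pair he)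

end fp

/-! ### The instance without Hamiltonian paths -/

/-- Two vertices far apart, no edges, ends `0` and `1`: a valid drawn instance of
`GRIDHAMPATHCOUNT` without Hamiltonian paths — the image of the strings that do not code a
normal-form formula ("a fixed instance without Hamiltonian paths").
[cite: LiskiewiczOgiharaToda2003, §3 (proof of Lemma 4)] -/
def zeroInstance : DrawnGraphInstance := ([((0 : ℤ), (0 : ℤ)), (2, 0)], [], 0, 1)

/-- The two-point drawing is a valid grid drawing. [folklore] -/
theorem isGridDrawing_zeroInstance : IsGridDrawing zeroInstance.1 zeroInstance.2.1 := by
  decide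

/-- Without edges there is no Hamiltonian `0`–`1` path on two vertices. [folklore] -/
theorem hamPathCount_zeroInstance : hamPathCount 2 ([] : List DrawnEdge) 0 1 = 0 := by
  rw [hamPathCount, Set.ncard_eq_zero (isHamPath_finite _ _ _ _), Set.eq_empty_iff_forall_notMem]
  rintro l ⟨hperm, hhead, hlast, hchain⟩
  have hlen : l.length = 2 := by simpa using hperm.length_eq
  match l, hlen with
  | [a, b], _ =>
    have hab : DAdj ([] : List DrawnEdge) a b := by
      have := hchain; simp [List.isChain_cons_cons] at this; exact this
    obtain ⟨e, he, _⟩ := hab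
    simp at he

/-- `GRIDHAMPATHCOUNT` vanishes on the code of `zeroInstance`. [cite: LiskiewiczOgiharaToda2003, §3 (proof of Lemma 4)] -/
theorem GRIDHAMPATHCOUNT_zeroInstance :
    GRIDHAMPATHCOUNT (encodingDrawnGraphInstance.encode zeroInstance) = 0 := by
  unfold zeroInstance
  rw [GRIDHAMPATHCOUNT_encode _ _ _ _ (by decide) (by decide) (by decide)]
  exact hamPathCount_zeroInstance

/-! ### Lemma 4 (gadget step) and Lemma 4 with the embedding, from a drawn family -/

/-- `SHARP3SATNF` through the total decoder of CNF codes. [cite: LiskiewiczOgiharaToda2003, Lemma 3 and §3] -/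
theorem SHARP3SATNF_eq_decCNF (w : List Bool) :
    SHARP3SATNF w =
      if (Literature.Computability.Complexity.NegCNF.decCNF w).IsLOTNormalForm then
        (Literature.Computability.Complexity.NegCNF.decCNF w).numSat else 0 := by
  simp [SHARP3SATNF, Literature.Computability.Complexity.cnfCountFn,
    Literature.Computability.Complexity.NegCNF.decode_cnf]

/-- **Lemma 4's gadget step from ANY drawn gadget family.** Given, for every CNF `ψ`, a named
grid drawing `S ψ` of a graph `G ψ` with end vertices `s ψ`, `t ψ` and an exponent `e ψ` such
that, whenever `ψ` is in the normal form of Lemma 3, the drawing is valid (congestion-free,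
maximum degree three), the ends are drawn, `0 < e ψ`, and
`#HamPath(G ψ, s ψ, t ψ) = 2^{e ψ} · #SAT(ψ)` ("each satisfying assignment is represented by
exactly `2^{48r+12n+312m+25}` Hamiltonian paths"), and given that the drawing data and the
exponent are polynomial-time computable from the code of `ψ` ("It is not hard to see that `R` is
polynomial-time computable"; "we apply our embedding algorithm to `G′`"), the named fact
`LOT2003_lemma4_gadgets : SHARP3SATNF ≤ᵖ_{r-shift} GRIDHAMPATHCOUNT` holds: `R₁` numbers the
drawing of `ψ_w = decCNF w` if `ψ_w` is in normal form and outputs `zeroInstance` otherwise,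
`R₃ w = max 1 (e ψ_w)`.
[cite: LiskiewiczOgiharaToda2003, §3 (proof of Lemma 4) and §4 (proof of Theorem 7, E₀)] -/
theorem LOT2003_lemma4_gadgets_of_family (S : CNF ℕ → SDrawing ℕ) (G : CNF ℕ → _root_.SimpleGraph ℕ)
    (s t e : CNF ℕ → ℕ)
    (hvalid : ∀ ψ : CNF ℕ, ψ.IsLOTNormalForm → (S ψ).IsValid)
    (hadj : ∀ ψ : CNF ℕ, ψ.IsLOTNormalForm → ∀ a ∈ (S ψ).verts, ∀ b ∈ (S ψ).verts,
      (G ψ).Adj a b ↔ ∃ d ∈ (S ψ).edges, (d.1 = a ∧ d.2.1 = b) ∨ (d.1 = b ∧ d.2.1 = a))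
    (hs : ∀ ψ : CNF ℕ, ψ.IsLOTNormalForm → s ψ ∈ (S ψ).verts)
    (ht : ∀ ψ : CNF ℕ, ψ.IsLOTNormalForm → t ψ ∈ (S ψ).verts)
    (he : ∀ ψ : CNF ℕ, ψ.IsLOTNormalForm → 0 < e ψ)
    (hcount : ∀ ψ : CNF ℕ, ψ.IsLOTNormalForm →
      hamCount (G ψ) (S ψ).verts.toFinset (s ψ) (t ψ) = 2 ^ e ψ * ψ.numSat)
    (hSFP : CodeFP cnfC ndC fun ψ => ((S ψ).verts, (S ψ).verts.map (S ψ).pos, (S ψ).edges, s ψ, t ψ))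
    (heFP : CodeFP cnfC natE e) :
    LOT2003_lemma4_gadgets := by
  classical
  -- the instance map on CNFs, and its string version
  set inst : CNF ℕ → DrawnGraphInstance := fun ψ =>
    if decide ψ.IsLOTNormalForm then
      numberND ((S ψ).verts, (S ψ).verts.map (S ψ).pos, (S ψ).edges, s ψ, t ψ)
    else zeroInstance with hinst
  have hinstFP : CodeFP cnfC instC inst :=
    codeFP_isLOTNormalForm.ite (codeFP_numberND.comp hSFP) (CodeFP.const _ zeroInstance)
  obtain ⟨F₁, hF₁, hF₁eq⟩ := hinstFP
  obtain ⟨F₃, hF₃, hF₃eq⟩ := codeFP_max_one heFP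
  let ψ_ : List Bool → CNF ℕ := Literature.Computability.Complexity.NegCNF.decCNF
  have hcanon : ∀ w, Literature.Computability.Complexity.KSATRed.canonCNFFn w = cnfC (ψ_ w) := fun w => by
    rw [Literature.Computability.Complexity.KSATRed.canonCNFFn_eq, cnfC_eq]
  refine ⟨F₁ ∘ Literature.Computability.Complexity.KSATRed.canonCNFFn,
    comp_mem_FP hF₁ Literature.Computability.Complexity.KSATRed.canonCNFFn_mem_FP,
    fun w => max 1 (e (ψ_ w)), ?_, fun w => Nat.lt_of_lt_of_le Nat.one_pos (le_max_left _ _), fun w => ?_⟩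
  · have : (encodeNat ∘ fun w => max 1 (e (ψ_ w))) =
        F₃ ∘ Literature.Computability.Complexity.KSATRed.canonCNFFn := by
      funext w
      rw [Function.comp_apply, Function.comp_apply, hcanon, hF₃eq]
    rw [this]
    exact comp_mem_FP hF₃ Literature.Computability.Complexity.KSATRed.canonCNFFn_mem_FP
  · dsimp only
    rw [Function.comp_apply, hcanon, hF₁eq, ← instC_eq, SHARP3SATNF_eq_decCNF]
    by_cases hnf : (ψ_ w).IsLOTNormalForm
    · have hinstw : inst (ψ_ w) = ((S (ψ_ w)).toP, (S (ψ_ w)).toD, (S (ψ_ w)).idx (s (ψ_ w)),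
          (S (ψ_ w)).idx (t (ψ_ w))) := by
        rw [hinst]; simp only [hnf, decide_true, if_true]; exact numberND_sdrawing _ _ _
      rw [if_pos hnf, hinstw, (hvalid _ hnf).GRIDHAMPATHCOUNT_encode_eq_hamCount _ (hadj _ hnf) (hs _ hnf)
        (ht _ hnf), hcount _ hnf, max_eq_right (Nat.one_le_iff_ne_zero.2 (he _ hnf).ne'),
        Nat.mul_div_cancel_left _ (Nat.two_pow_pos _)]
    · have hinstw : inst (ψ_ w) = zeroInstance := by
        rw [hinst]; simp only [hnf, decide_false]; rfl
      rw [if_neg hnf, hinstw, GRIDHAMPATHCOUNT_zeroInstance, Nat.zero_div]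

/-- **Lemma 4 with the embedding (`LOT2003_lemma4_grid`: every `#P` function is
`≤ᵖ_{r-shift}`-reducible to `GRIDHAMPATHCOUNT`) from any drawn gadget family**, by Proposition 2
(`LOT2003_prop2_sharp3SAT_holds`), Lemma 3 (`LOT2003_lemma3_holds`) and Proposition 1
(`LOT2003_lemma4_grid_of_gadgets`). [cite: LiskiewiczOgiharaToda2003, Proposition 1, Proposition 2, Lemma 3, Lemma 4 and §4 (E₀)] -/
theorem LOT2003_lemma4_grid_of_family (S : CNF ℕ → SDrawing ℕ) (G : CNF ℕ → _root_.SimpleGraph ℕ)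
    (s t e : CNF ℕ → ℕ)
    (hvalid : ∀ ψ : CNF ℕ, ψ.IsLOTNormalForm → (S ψ).IsValid)
    (hadj : ∀ ψ : CNF ℕ, ψ.IsLOTNormalForm → ∀ a ∈ (S ψ).verts, ∀ b ∈ (S ψ).verts,
      (G ψ).Adj a b ↔ ∃ d ∈ (S ψ).edges, (d.1 = a ∧ d.2.1 = b) ∨ (d.1 = b ∧ d.2.1 = a))
    (hs : ∀ ψ : CNF ℕ, ψ.IsLOTNormalForm → s ψ ∈ (S ψ).verts)
    (ht : ∀ ψ : CNF ℕ, ψ.IsLOTNormalForm → t ψ ∈ (S ψ).verts)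
    (he : ∀ ψ : CNF ℕ, ψ.IsLOTNormalForm → 0 < e ψ)
    (hcount : ∀ ψ : CNF ℕ, ψ.IsLOTNormalForm →
      hamCount (G ψ) (S ψ).verts.toFinset (s ψ) (t ψ) = 2 ^ e ψ * ψ.numSat)
    (hSFP : CodeFP cnfC ndC fun ψ => ((S ψ).verts, (S ψ).verts.map (S ψ).pos, (S ψ).edges, s ψ, t ψ))
    (heFP : CodeFP cnfC natE e) :
    LOT2003_lemma4_grid :=
  LOT2003_lemma4_grid_of_gadgets LOT2003_prop2_sharp3SAT_holds
    (LOT2003_lemma4_gadgets_of_family S G s t e hvalid hadj hs ht he hcount hSFP heFP)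

/-! ### Variant: families that number their drawings themselves -/

/-- `hamPathCount` does not depend on the drawn paths, only on the end pairs: the value of
`GRIDHAMPATHCOUNT` on the code of a valid numbered instance. Restated for families that build the
numbered instance `(P, D, s, t)` directly (grid-native constructions whose vertices ARE numbers).
[cite: LiskiewiczOgiharaToda2003, §4 (proof of Theorem 7, E₀)] -/
theorem GRIDHAMPATHCOUNT_instC (I : DrawnGraphInstance) (hI : IsGridDrawing I.1 I.2.1)
    (hs : I.2.2.1 < I.1.length) (ht : I.2.2.2 < I.1.length) :
    GRIDHAMPATHCOUNT (instC I) = hamPathCount I.1.length I.2.1 I.2.2.1 I.2.2.2 := by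
  obtain ⟨P, D, s, t⟩ := I
  rw [← instC_eq]
  exact GRIDHAMPATHCOUNT_encode P D s t hI hs ht

/-- **Lemma 4's gadget step from a family of NUMBERED drawn instances**: the same as
`LOT2003_lemma4_gadgets_of_family` for a construction that delivers, for every normal-form `ψ`,
the instance `inst ψ = (P, D, s, t)` of `GRIDHAMPATHCOUNT` itself — a congestion-free grid drawing
with `s, t < |P|` and `hamPathCount |P| D s t = 2^{e ψ} · #SAT(ψ)` — computed in typed polynomial
time from the code of `ψ` (`CodeFP cnfC instC inst`), together with the exponent.
[cite: LiskiewiczOgiharaToda2003, §3 (proof of Lemma 4) and §4 (proof of Theorem 7, E₀)] -/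
theorem LOT2003_lemma4_gadgets_of_numberedFamily (inst : CNF ℕ → DrawnGraphInstance) (e : CNF ℕ → ℕ)
    (hvalid : ∀ ψ : CNF ℕ, ψ.IsLOTNormalForm → IsGridDrawing (inst ψ).1 (inst ψ).2.1)
    (hs : ∀ ψ : CNF ℕ, ψ.IsLOTNormalForm → (inst ψ).2.2.1 < (inst ψ).1.length)
    (ht : ∀ ψ : CNF ℕ, ψ.IsLOTNormalForm → (inst ψ).2.2.2 < (inst ψ).1.length)
    (he : ∀ ψ : CNF ℕ, ψ.IsLOTNormalForm → 0 < e ψ)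
    (hcount : ∀ ψ : CNF ℕ, ψ.IsLOTNormalForm →
      hamPathCount (inst ψ).1.length (inst ψ).2.1 (inst ψ).2.2.1 (inst ψ).2.2.2 = 2 ^ e ψ * ψ.numSat)
    (hFP : CodeFP cnfC instC inst) (heFP : CodeFP cnfC natE e) :
    LOT2003_lemma4_gadgets := by
  classical
  set inst' : CNF ℕ → DrawnGraphInstance := fun ψ =>
    if decide ψ.IsLOTNormalForm then inst ψ else zeroInstance with hinst
  have hinstFP : CodeFP cnfC instC inst' :=
    codeFP_isLOTNormalForm.ite hFP (CodeFP.const _ zeroInstance)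
  obtain ⟨F₁, hF₁, hF₁eq⟩ := hinstFP
  obtain ⟨F₃, hF₃, hF₃eq⟩ := codeFP_max_one heFP
  let ψ_ : List Bool → CNF ℕ := Literature.Computability.Complexity.NegCNF.decCNF
  have hcanon : ∀ w, Literature.Computability.Complexity.KSATRed.canonCNFFn w = cnfC (ψ_ w) := fun w => by
    rw [Literature.Computability.Complexity.KSATRed.canonCNFFn_eq, cnfC_eq]
  refine ⟨F₁ ∘ Literature.Computability.Complexity.KSATRed.canonCNFFn,
    comp_mem_FP hF₁ Literature.Computability.Complexity.KSATRed.canonCNFFn_mem_FP,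
    fun w => max 1 (e (ψ_ w)), ?_, fun w => Nat.lt_of_lt_of_le Nat.one_pos (le_max_left _ _), fun w => ?_⟩
  · have : (encodeNat ∘ fun w => max 1 (e (ψ_ w))) =
        F₃ ∘ Literature.Computability.Complexity.KSATRed.canonCNFFn := by
      funext w
      rw [Function.comp_apply, Function.comp_apply, hcanon, hF₃eq]
    rw [this]
    exact comp_mem_FP hF₃ Literature.Computability.Complexity.KSATRed.canonCNFFn_mem_FP
  · dsimp only
    rw [Function.comp_apply, hcanon, hF₁eq, SHARP3SATNF_eq_decCNF]
    by_cases hnf : (ψ_ w).IsLOTNormalForm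
    · have hinstw : inst' (ψ_ w) = inst (ψ_ w) := by
        rw [hinst]; simp only [hnf, decide_true, if_true]
      rw [if_pos hnf, hinstw, GRIDHAMPATHCOUNT_instC _ (hvalid _ hnf) (hs _ hnf) (ht _ hnf), hcount _ hnf,
        max_eq_right (Nat.one_le_iff_ne_zero.2 (he _ hnf).ne'), Nat.mul_div_cancel_left _ (Nat.two_pow_pos _)]
    · have hinstw : inst' (ψ_ w) = zeroInstance := by
        rw [hinst]; simp only [hnf, decide_false]; rfl
      rw [if_neg hnf, hinstw, ← instC_eq, GRIDHAMPATHCOUNT_zeroInstance, Nat.zero_div]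

/-- `LOT2003_lemma4_grid` from a family of numbered drawn instances (Proposition 2, Lemma 3,
Proposition 1). [cite: LiskiewiczOgiharaToda2003, Proposition 1, Proposition 2, Lemma 3, Lemma 4 and §4 (E₀)] -/
theorem LOT2003_lemma4_grid_of_numberedFamily (inst : CNF ℕ → DrawnGraphInstance) (e : CNF ℕ → ℕ)
    (hvalid : ∀ ψ : CNF ℕ, ψ.IsLOTNormalForm → IsGridDrawing (inst ψ).1 (inst ψ).2.1)
    (hs : ∀ ψ : CNF ℕ, ψ.IsLOTNormalForm → (inst ψ).2.2.1 < (inst ψ).1.length)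
    (ht : ∀ ψ : CNF ℕ, ψ.IsLOTNormalForm → (inst ψ).2.2.2 < (inst ψ).1.length)
    (he : ∀ ψ : CNF ℕ, ψ.IsLOTNormalForm → 0 < e ψ)
    (hcount : ∀ ψ : CNF ℕ, ψ.IsLOTNormalForm →
      hamPathCount (inst ψ).1.length (inst ψ).2.1 (inst ψ).2.2.1 (inst ψ).2.2.2 = 2 ^ e ψ * ψ.numSat)
    (hFP : CodeFP cnfC instC inst) (heFP : CodeFP cnfC natE e) :
    LOT2003_lemma4_grid :=
  LOT2003_lemma4_grid_of_gadgets LOT2003_prop2_sharp3SAT_holds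
    (LOT2003_lemma4_gadgets_of_numberedFamily inst e hvalid hs ht he hcount hFP heFP)

end Literature.Barriers.CriticalPhenomena.GridSAW
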